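import Summits.AtomisticToContinuum.Crystallization.Theorems.PalmUnimodularRigidityMinimiserShellsSlackCertificates

/-!
# The defect transport: mass RECEIVED at the root
(stub `stub_defectTransportReceived` of line `octahedral-annulus-mandate`, crux `MinimiserShells`,
stmt-AtomisticToContinuum-9225)

Route `PalmUnimodularRigidity`, crux decl
`Summit.AtomisticToContinuum.Crystallization.Theses.PalmUnimodularRigidity.MinimiserShells`, lead
`prover-line-stmt-AtomisticToContinuum-9225-c10-0` (reshape r3, stub 1d).

The DEFECT TRANSPORT of the line surcharges the random-grid transport of item 9229
(`EnergyFloor.transport`): at mesh `L`, phase `v ∈ [0,1)³` and surcharge `c`, the root sends `c / #C_v` to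
every cell-mate `w ∈ C_v = rootCell L v` whose cell cluster re-rooted at `w`, `(μ|C_v).map (· − w)`, lies
outside the (measurable) event `B` — through the truncation `trunc δ`, so that it is defined for every
measure: `dT(ν, w) = ∫_{[0,1)³} 1[w ∈ C_v] · c·1[((trunc δ ν)|C_v).map (· − w) ∉ B] / (trunc δ ν)(C_v) dv`.

**Theorem** (`stub_defectTransportReceived`).  On a rooted `δ`-hard-core configuration `μ = count|S` the
total defect mass RECEIVED at the root is
`∑_{y ∈ S} dT(θ_y μ, −y) = ∫_{[0,1)³} c·1[μ|C_v ∉ B] dv`, `θ_y μ = μ.map (· − y)`.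

**Proof** (template: `EnergyFloor.le_lintegral_transport_map`).  Step 1: inside `dT(θ_y μ, −y)` shift the
phase `v ↦ v − L⁻¹•y` (`setLIntegral_phaseDom_sub`; the integrand depends on `v` only through `C_v`, which
is `ℤ³`-periodic, `rootCell_int_add`).  Step 2: swap the sum over `y ∈ S` with the phase integral
(`lintegral_count_restrict_setLIntegral_comm`).  Step 3, per phase `v`: `−y ∈ C_{v − L⁻¹y} ↔ y ∈ C_v`
(`neg_mem_rootCell_iff`); for a cell-mate `y ∈ C_v ∩ S` the re-rooted configuration is again rooted
`δ`-hard-core (`IsRootedHardCore.map_sub`, so `trunc` does nothing), its root cell at the shifted phase pulls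
back under `· − y` to `C_v` (`preimage_sub_rootCell`), so its re-rooted cell cluster shifted back by `+y`
is `μ|C_v` itself (`map_sub_restrict_rootCell_map`) and its cell count is `μ(C_v) = #(C_v ∩ S)`
(`map_sub_apply_rootCell`); the `#(C_v ∩ S)` senders thus contribute `c·1[μ|C_v ∉ B] / #(C_v ∩ S)`
each.  Measurability in the phase (needed for Steps 1–2) comes from the s-finite truncated configuration
kernel (`measurable_trunc_apply`) through `Measure.measurable_of_measurable_coe`
(`measurable_restrict_rootCell_map_sub`).
-/

noncomputable section

open MeasureTheory Filter Set
open scoped ENNReal BigOperators Topology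

namespace Summit.AtomisticToContinuum.Crystallization.Theorems.PalmUnimodularRigidityMinimiserShells.DefectTransportReceived

open Literature.Probability.Process (IsRootedHardCore count_restrict_singleton_ne_zero_iff
  map_sub_count_restrict)
open Summit.AtomisticToContinuum.Crystallization.Theorems.MinimiserShells.Negative.Rootedness
  (E3 countable_of_separated)
open Summit.AtomisticToContinuum.Crystallization.Theorems.PalmUnimodularRigidityMinimiserShells.EnergyFloor

variable {δ L : ℝ}

/-! ## Measurability in the phase -/

/-- For a fixed measure `ν`, the re-rooted truncated cell cluster
`(v, w) ↦ ((trunc δ ν)|C_v).map (· − w)` is a measurable map into measures: its evaluation at a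
measurable `A` is the truncated-kernel count of the measurable set `{z | z − w ∈ A, z ∈ C_v}`
(`measurable_trunc_apply`). -/
theorem measurable_restrict_rootCell_map_sub (δ L : ℝ) (ν : Measure E3) :
    Measurable fun p : E3 × E3 => ((trunc δ ν).restrict (rootCell L p.1)).map (fun z => z - p.2) := by
  refine Measure.measurable_of_measurable_coe _ fun A hA => ?_
  have hs : MeasurableSet
      {q : (E3 × E3) × E3 | q.2 - q.1.2 ∈ A ∧ cellIdx L q.1.1 q.2 = cellIdx L q.1.1 0} :=
    (hA.preimage (measurable_snd.sub measurable_fst.snd)).inter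
      ((measurableSet_cellIdx_eq L 0).preimage (measurable_fst.fst.prodMk measurable_snd))
  have heq : (fun p : E3 × E3 => ((trunc δ ν).restrict (rootCell L p.1)).map (fun z => z - p.2) A) =
      (fun r : Measure E3 × (E3 × E3) => trunc δ r.1 {z | (r.2, z) ∈
        {q : (E3 × E3) × E3 | q.2 - q.1.2 ∈ A ∧ cellIdx L q.1.1 q.2 = cellIdx L q.1.1 0}}) ∘
        Prod.mk ν := by
    funext p
    rw [Function.comp_apply, Measure.map_apply (measurable_sub_const _) hA,
      Measure.restrict_apply (hA.preimage (measurable_sub_const _))]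
    rfl
  show Measurable fun p : E3 × E3 => ((trunc δ ν).restrict (rootCell L p.1)).map (fun z => z - p.2) A
  rw [heq]
  exact (measurable_trunc_apply hs).comp measurable_prodMk_left

/-- The defect-transport integrand at a fixed configuration `ν`,
`(v, w) ↦ 1[w ∈ C_v] · c·1[((trunc δ ν)|C_v).map (· − w) ∉ B] / (trunc δ ν)(C_v)`, is jointly measurable
in (phase, point). -/
theorem measurable_defect_integrand {B : Set (Measure E3)} (hB : MeasurableSet B) (c δ L : ℝ)
    (ν : Measure E3) :
    Measurable fun p : E3 × E3 => (rootCell L p.1).indicator (fun w => Bᶜ.indicator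
      (fun _ => ENNReal.ofReal c) (((trunc δ ν).restrict (rootCell L p.1)).map (fun z => z - w)) /
        trunc δ ν (rootCell L p.1)) p.2 := by
  have hnum : Measurable fun p : E3 × E3 => Bᶜ.indicator (fun _ => ENNReal.ofReal c)
      (((trunc δ ν).restrict (rootCell L p.1)).map (fun z => z - p.2)) :=
    ((measurable_const (a := ENNReal.ofReal c)).indicator hB.compl).comp
      (measurable_restrict_rootCell_map_sub δ L ν)
  have hden : Measurable fun p : E3 × E3 => trunc δ ν (rootCell L p.1) :=
    (measurable_trunc_rootCell δ L).comp ((measurable_prodMk_left (x := ν)).comp measurable_fst)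
  exact measurable_indicator_param (s := rootCell L) (measurableSet_cellIdx_eq L 0) (hnum.div hden)

/-- For a fixed configuration and a fixed point, the defect-transport integrand is measurable in the
phase. -/
theorem measurable_defect_integrand_phase {B : Set (Measure E3)} (hB : MeasurableSet B) (c δ L : ℝ)
    (ν : Measure E3) (w : E3) :
    Measurable fun v : E3 => (rootCell L v).indicator (fun w => Bᶜ.indicator
      (fun _ => ENNReal.ofReal c) (((trunc δ ν).restrict (rootCell L v)).map (fun z => z - w)) /
        trunc δ ν (rootCell L v)) w :=
  (measurable_defect_integrand hB c δ L ν).comp (measurable_prodMk_right (y := w))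

/-! ## Re-rooting at a cell-mate -/

/-- SHIFT BACK: for `y` in the root's cell, the configuration re-rooted at `y`, restricted to its root
cell at the shifted phase `v − L⁻¹•y` and shifted back by `+y`, is the configuration restricted to the
root's cell. -/
theorem map_sub_restrict_rootCell_map (hL : L ≠ 0) {v y : E3} (hy : y ∈ rootCell L v)
    (μ : Measure E3) :
    ((μ.map fun z => z - y).restrict (rootCell L (v - L⁻¹ • y))).map (fun z => z - -y) =
      μ.restrict (rootCell L v) := by
  rw [Measure.restrict_map (measurable_sub_const y) (measurableSet_rootCell L _),
    preimage_sub_rootCell hL hy, Measure.map_map (measurable_sub_const (-y)) (measurable_sub_const y)]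
  have hid : ((fun z : E3 => z - -y) ∘ fun z => z - y) = id := by
    funext z
    simp
  rw [hid, Measure.map_id]

/-- SHIFT: the configuration re-rooted at a point `y` of the root's cell gives its root cell at the
shifted phase the mass of the old root's cell. -/
theorem map_sub_apply_rootCell (hL : L ≠ 0) {v y : E3} (hy : y ∈ rootCell L v) (μ : Measure E3) :
    (μ.map fun z => z - y) (rootCell L (v - L⁻¹ • y)) = μ (rootCell L v) := by
  rw [Measure.map_apply (measurable_sub_const y) (measurableSet_rootCell L _),
    preimage_sub_rootCell hL hy]

/-! ## The defect mass received at a fixed phase -/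

/-- **Defect mass received at the root at a fixed phase.**  For `μ = count|S` rooted `δ`-hard-core and
a phase `v`: `∑_{y ∈ S} 1[−y ∈ C_{v−L⁻¹y}] · c·1[((trunc δ θ_y μ)|C_{v−L⁻¹y}).map (· + y) ∉ B] /
(trunc δ θ_y μ)(C_{v−L⁻¹y}) = c·1[μ|C_v ∉ B]` — the senders are exactly the `#(C_v ∩ S)` cell-mates
of the root, each contributing `c·1[μ|C_v ∉ B] / #(C_v ∩ S)`. -/
theorem lintegral_defect_received_phase (B : Set (Measure E3)) (c : ℝ) (hδ : 0 < δ) (hL : 0 < L)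
    {S : Set E3} (h0 : (0 : E3) ∈ S) (hsep : ∀ x ∈ S, ∀ y ∈ S, x ≠ y → δ ≤ dist x y) (v : E3) :
    ∫⁻ y, (rootCell L (v - L⁻¹ • y)).indicator (fun w => Bᶜ.indicator (fun _ => ENNReal.ofReal c)
        (((trunc δ (((Measure.count : Measure E3).restrict S).map fun z => z - y)).restrict
          (rootCell L (v - L⁻¹ • y))).map (fun z => z - w)) /
          trunc δ (((Measure.count : Measure E3).restrict S).map fun z => z - y)
            (rootCell L (v - L⁻¹ • y))) (-y) ∂((Measure.count : Measure E3).restrict S) =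
      Bᶜ.indicator (fun _ => ENNReal.ofReal c)
        (((Measure.count : Measure E3).restrict S).restrict (rootCell L v)) := by
  obtain ⟨T, hT, h0T⟩ := exists_cluster hδ hL h0 hsep v
  have hL0 : L ≠ 0 := hL.ne'
  have hμ : IsRootedHardCore δ ((Measure.count : Measure E3).restrict S) := ⟨S, h0, hsep, rfl⟩
  -- the integrand is supported on the root's cell
  have hpt : ∀ y : E3, (rootCell L (v - L⁻¹ • y)).indicator (fun w => Bᶜ.indicator
      (fun _ => ENNReal.ofReal c)
      (((trunc δ (((Measure.count : Measure E3).restrict S).map fun z => z - y)).restrict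
        (rootCell L (v - L⁻¹ • y))).map (fun z => z - w)) /
        trunc δ (((Measure.count : Measure E3).restrict S).map fun z => z - y)
          (rootCell L (v - L⁻¹ • y))) (-y) =
      (rootCell L v).indicator (fun y => Bᶜ.indicator (fun _ => ENNReal.ofReal c)
      (((trunc δ (((Measure.count : Measure E3).restrict S).map fun z => z - y)).restrict
        (rootCell L (v - L⁻¹ • y))).map (fun z => z - -y)) /
        trunc δ (((Measure.count : Measure E3).restrict S).map fun z => z - y)
          (rootCell L (v - L⁻¹ • y))) y := by
    intro y
    by_cases hy : y ∈ rootCell L v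
    · rw [Set.indicator_of_mem ((neg_mem_rootCell_iff hL0 v y).2 hy), Set.indicator_of_mem hy]
    · rw [Set.indicator_of_notMem (fun h => hy ((neg_mem_rootCell_iff hL0 v y).1 h)),
        Set.indicator_of_notMem hy]
  simp_rw [hpt]
  rw [lintegral_indicator (measurableSet_rootCell L v), setLIntegral_rootCell_eq_sum hT]
  -- evaluate the summands: every cell-mate sends `c·1[μ|C_v ∉ B] / #T`
  have heval : ∀ y ∈ T, Bᶜ.indicator (fun _ => ENNReal.ofReal c)
      (((trunc δ (((Measure.count : Measure E3).restrict S).map fun z => z - y)).restrict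
        (rootCell L (v - L⁻¹ • y))).map (fun z => z - -y)) /
        trunc δ (((Measure.count : Measure E3).restrict S).map fun z => z - y)
          (rootCell L (v - L⁻¹ • y)) =
      Bᶜ.indicator (fun _ => ENNReal.ofReal c)
        (((Measure.count : Measure E3).restrict S).restrict (rootCell L v)) / T.card := by
    intro y hy
    have hyS : y ∈ rootCell L v ∩ S := by rw [← hT]; exact hy
    have hν := hμ.map_sub ((count_restrict_singleton_ne_zero_iff S y).2 hyS.2)
    rw [trunc_of_mem (mem_hcClass_of_hc hδ hν), map_sub_restrict_rootCell_map hL0 hyS.1,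
      map_sub_apply_rootCell hL0 hyS.1, count_restrict_rootCell_eq_card hT]
  rw [Finset.sum_congr rfl heval, Finset.sum_const, nsmul_eq_mul]
  have hcard0 : (T.card : ℝ≥0∞) ≠ 0 := by exact_mod_cast (Finset.card_pos.2 ⟨0, h0T⟩).ne'
  exact ENNReal.mul_div_cancel hcard0 (ENNReal.natCast_ne_top _)

/-! ## The stub -/

/-- **STUB 1d of line `octahedral-annulus-mandate` — the defect transport: mass RECEIVED.**  On a rooted
`δ`-hard-core configuration `μ = count|S` the total defect mass received at the root,
`∑_{y ∈ S} dT(θ_y μ, −y)`, is `∫_{[0,1)³} c·1[μ|C_v ∉ B] dv`: after the phase shift `v ↦ v − L⁻¹y`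
(`setLIntegral_phaseDom_sub`, `rootCell_int_add`) the sender `y` and the root share the cell `C_v`
(`neg_mem_rootCell_iff`, `preimage_sub_rootCell`), the sender's re-rooted cell cluster shifted back by `+y`
is `μ|C_v` itself, and the `#cell` senders each contribute `c·1[μ|C_v ∉ B]/#cell` (swap by
`lintegral_count_restrict_setLIntegral_comm`; `IsRootedHardCore.map_sub` keeps `θ_y μ` in the class,
`trunc_of_mem`). -/
theorem stub_defectTransportReceived :
    ∀ B : Set (Measure E3), MeasurableSet B → ∀ c δ L : ℝ, 0 < δ → 0 < L →
      ∀ μ : Measure E3, IsRootedHardCore δ μ →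
        ∫⁻ y, (∫⁻ v in phaseDom, (rootCell L v).indicator (fun w => Bᶜ.indicator (fun _ => ENNReal.ofReal c)
          (((trunc δ (μ.map fun z => z - y)).restrict (rootCell L v)).map (fun z => z - w)) /
            trunc δ (μ.map fun z => z - y) (rootCell L v)) (-y)) ∂μ =
        ∫⁻ v in phaseDom, Bᶜ.indicator (fun _ => ENNReal.ofReal c) (μ.restrict (rootCell L v)) := by
  intro B hB c δ L hδ hL μ hμ
  obtain ⟨S, h0, hsep, rfl⟩ := hμ
  have hS := countable_of_separated hδ hsep
  -- Step 1: phase shift inside the defect transport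
  have hshift : ∀ (ν : Measure E3) (y : E3),
      ∫⁻ v in phaseDom, (rootCell L v).indicator (fun w => Bᶜ.indicator (fun _ => ENNReal.ofReal c)
          (((trunc δ ν).restrict (rootCell L v)).map (fun z => z - w)) / trunc δ ν (rootCell L v)) (-y) =
        ∫⁻ v in phaseDom, (rootCell L (v - L⁻¹ • y)).indicator (fun w => Bᶜ.indicator
          (fun _ => ENNReal.ofReal c)
          (((trunc δ ν).restrict (rootCell L (v - L⁻¹ • y))).map (fun z => z - w)) /
            trunc δ ν (rootCell L (v - L⁻¹ • y))) (-y) := fun ν y =>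
    (setLIntegral_phaseDom_sub (measurable_defect_integrand_phase hB c δ L ν (-y))
      (fun k hk w => by simp only [rootCell_int_add hk]) (L⁻¹ • y)).symm
  simp_rw [hshift]
  -- Step 2: swap the configuration sum with the phase integral
  rw [lintegral_count_restrict_setLIntegral_comm hS
    (F := fun y v => (rootCell L (v - L⁻¹ • y)).indicator (fun w => Bᶜ.indicator
      (fun _ => ENNReal.ofReal c)
      (((trunc δ (((Measure.count : Measure E3).restrict S).map fun z => z - y)).restrict
        (rootCell L (v - L⁻¹ • y))).map (fun z => z - w)) /
        trunc δ (((Measure.count : Measure E3).restrict S).map fun z => z - y)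
          (rootCell L (v - L⁻¹ • y))) (-y))
    (fun y => (measurable_defect_integrand_phase hB c δ L _ (-y)).comp (measurable_sub_const _))
    phaseDom]
  -- Step 3: evaluate at every phase
  exact lintegral_congr fun v => lintegral_defect_received_phase B c hδ hL h0 hsep v

end Summit.AtomisticToContinuum.Crystallization.Theorems.PalmUnimodularRigidityMinimiserShells.DefectTransportReceived

end
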